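import Literature.Analysis.SegalBargmann.HermiteMoments
import Literature.Analysis.SegalBargmann.SchwartzTorusIdentification
import Literature.Analysis.SegalBargmann.SchwartzMetaplecticGenerators
import HarnessLib

/-!
# The Gaussian second moment `⟪h₀, (x·bx) h₀⟫ = tr(b)/(4π)`

For the vacuum `h₀ = hermitePi 0` of `L²(ℝ^σ)` (Folland's normalised Gaussian on the sup-norm carrier `σ → ℝ`,
tree file `SchwartzTorusIdentification`) and any linear `b : ℝ^σ → ℝ^σ`, the matrix coefficient of the
multiplication operator by the quadratic form `x ↦ x·bx` is

  `⟪toL2 (hermitePi 0), toL2 (quadMulS b (hermitePi 0))⟫ = tr(b) / (4π)`.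

Proof: on the Euclidean carrier the ladder formula `x_j h_0 = ½√(1/π) h_{1_j}` (tree `coordMulCLM_herm`) and
orthonormality give `∫ x_j x_k h_0² = δ_{jk}/(4π)` (the diagonal case is tree `bpair_coordMulCLM_herm_self`);
summing against the matrix of `b` gives `tr(b)/(4π)`, and the volume-preserving identification
`EuclideanSpace ℝ σ ≃ (σ → ℝ)` (tree `euclE`) transports the scalar identity to Folland's carrier and to the `L²`
inner product.  This is the real Gaussian moment that carries the zero-point weight of the chirp generator
`-πi x·bx` (file `SchwartzChirpDerivative`) in the theta lane's design note `W2inf-zp-design.md`.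

References (provenance only; no statement of print is asserted as a hypothesis): Folland 1989, *Harmonic Analysis
in Phase Space*, §1.7 (Hermite functions), (1.82); Ch. 4 §2 (4.25).
-/

noncomputable section

open MeasureTheory Complex SchwartzMap Filter Topology
open scoped InnerProductSpace ComplexConjugate Real BigOperators

namespace Literature.Analysis.SegalBargmann

/-- `L²(ℝ^σ)` for Lebesgue measure. -/
local notation "L2R" σ:max => (Lp ℂ 2 (volume : Measure (σ → ℝ)))
/-- Folland's Schwartz space on the sup-norm carrier. -/
local notation "SR" σ:max => (SchwartzMap (σ → ℝ) ℂ)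
/-- Schwartz space on the Euclidean carrier. -/
local notation "SE" σ:max => (SchwartzMap (EuclideanSpace ℝ σ) ℂ)

variable {σ : Type*} [Fintype σ] [DecidableEq σ]

/-! ## 1. Euclidean carrier: `∫ x_j x_k h_0² = δ_{jk}/(4π)` -/

/-- **`x_j h_0 = ½√(1/π) · h_{1_j}`** (the lowering term of Folland (1.82) vanishes on the vacuum).
[cite: Folland1989, (1.82)] -/
theorem coordMulCLM_herm_zero (j : σ) :
    coordMulCLM j (hermiteSchwartz (herm (0 : σ →₀ ℕ))) =
      ((1 / 2 : ℂ) * (Real.sqrt (1 / π) : ℂ)) • hermiteSchwartz (herm (Finsupp.single j 1)) := by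
  rw [coordMulCLM_herm, zero_add]
  have h0 : (((0 : σ →₀ ℕ) j : ℕ) : ℝ) = 0 := by
    rw [Finsupp.coe_zero, Pi.zero_apply, Nat.cast_zero]
  rw [h0, zero_add, zero_div, Real.sqrt_zero, Complex.ofReal_zero, mul_zero, zero_smul, add_zero]

/-- **Second moments of the vacuum**: `∫ x_j x_k h_0(x)² dx = δ_{jk} / (4π)`. [cite: Folland1989, §1.7] -/
theorem bpair_coordMulCLM_herm_zero (j k : σ) :
    bpair (coordMulCLM j (hermiteSchwartz (herm (0 : σ →₀ ℕ)))) (coordMulCLM k (hermiteSchwartz (herm (0 : σ →₀ ℕ)))) =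
      if j = k then (((1 / (4 * π) : ℝ)) : ℂ) else 0 := by
  rw [coordMulCLM_herm_zero, coordMulCLM_herm_zero, bpair_smul_left, bpair_smul_right, bpair_herm_herm]
  by_cases hjk : j = k
  · subst hjk
    rw [if_pos rfl, if_pos rfl, mul_one]
    have hπ : (0 : ℝ) ≤ 1 / π := by positivity
    have hs : (Real.sqrt (1 / π) : ℂ) * (Real.sqrt (1 / π) : ℂ) = ((1 / π : ℝ) : ℂ) := by
      rw [← Complex.ofReal_mul, Real.mul_self_sqrt hπ]
    push_cast at hs ⊢
    linear_combination (1 / 4 : ℂ) * hs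
  · rw [if_neg (mt (Finsupp.single_left_inj one_ne_zero).1 hjk), if_neg hjk, mul_zero, mul_zero]

/-- The same moments with both coordinate multiplications on the right: `⟨h_0, x_j x_k h_0⟩ = δ_{jk}/(4π)`.
[cite: Folland1989, §1.7] -/
theorem bpair_herm_zero_coordMulCLM_coordMulCLM (j k : σ) :
    bpair (hermiteSchwartz (herm (0 : σ →₀ ℕ)))
        (coordMulCLM j (coordMulCLM k (hermiteSchwartz (herm (0 : σ →₀ ℕ))))) =
      if j = k then (((1 / (4 * π) : ℝ)) : ℂ) else 0 := by
  rw [bpair_coordMulCLM, bpair_coordMulCLM_herm_zero]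

/-- The quadratic-form multiple `Σ_{j,k} B_{jk} x_j x_k · h_0` on the Euclidean carrier (as a Schwartz function). [folklore] -/
def quadHermZeroE (B : Matrix σ σ ℝ) : SE σ :=
  ∑ j : σ, ∑ k : σ, ((B j k : ℝ) : ℂ) • coordMulCLM j (coordMulCLM k (hermiteSchwartz (herm (0 : σ →₀ ℕ))))

/-- **`⟨h_0, (xᵀBx) h_0⟩ = tr(B)/(4π)`** on the Euclidean carrier. [cite: Folland1989, §1.7] -/
theorem bpair_herm_zero_quadHermZeroE (B : Matrix σ σ ℝ) :
    bpair (hermiteSchwartz (herm (0 : σ →₀ ℕ))) (quadHermZeroE B) = ((B.trace / (4 * π) : ℝ) : ℂ) := by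
  rw [quadHermZeroE, bpair_sum_right]
  simp_rw [bpair_sum_right, bpair_smul_right, bpair_herm_zero_coordMulCLM_coordMulCLM, mul_ite, mul_zero,
    Finset.sum_ite_eq, Finset.mem_univ, if_true]
  rw [Matrix.trace, Finset.sum_div, Complex.ofReal_sum]
  refine Finset.sum_congr rfl fun j _ => ?_
  rw [Matrix.diag_apply]
  push_cast
  ring

/-- Pointwise: `quadHermZeroE B (y) = (Σ_{j,k} y_j B_{jk} y_k) · h_0(y)`. [folklore] -/
theorem quadHermZeroE_apply (B : Matrix σ σ ℝ) (y : EuclideanSpace ℝ σ) :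
    quadHermZeroE B y =
      ((∑ j : σ, ∑ k : σ, y j * (B j k * y k) : ℝ) : ℂ) * hermiteFun (herm (0 : σ →₀ ℕ)) (⇑y : σ → ℝ) := by
  rw [quadHermZeroE, sum_apply, Complex.ofReal_sum, Finset.sum_mul]
  refine Finset.sum_congr rfl fun j _ => ?_
  rw [sum_apply, Complex.ofReal_sum, Finset.sum_mul]
  refine Finset.sum_congr rfl fun k _ => ?_
  rw [smul_apply, smul_eq_mul, coordMulCLM_apply, coordMulCLM_apply, hermiteSchwartz_apply]
  push_cast
  ring

/-! ## 2. Folland's carrier: the quadratic-form multiplier and the `L²` matrix coefficient -/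

/-- **Multiplication by the quadratic form `x ↦ x·bx`** on Folland's Schwartz space `𝓢(ℝ^σ)` (the real part of
the chirp generator: `chirpGen b = -πi · quadMulS b`). [cite: Folland1989, (4.25)] -/
def quadMulS (b : (σ → ℝ) →ₗ[ℝ] (σ → ℝ)) : (SR σ) →L[ℂ] SR σ :=
  SchwartzMap.smulLeftCLM ℂ fun x : σ → ℝ => ((x ⬝ᵥ b x : ℝ) : ℂ)

omit [DecidableEq σ] in
/-- The quadratic form, read in `ℂ`, has temperate growth. [folklore] -/
theorem hasTemperateGrowth_ofReal_quadForm (b : (σ → ℝ) →ₗ[ℝ] (σ → ℝ)) :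
    (fun x : σ → ℝ => ((x ⬝ᵥ b x : ℝ) : ℂ)).HasTemperateGrowth :=
  Complex.ofRealCLM.hasTemperateGrowth.comp (hasTemperateGrowth_quadForm b)

omit [DecidableEq σ] in
/-- Pointwise formula. [cite: Folland1989, (4.25)] -/
@[simp] theorem quadMulS_apply (b : (σ → ℝ) →ₗ[ℝ] (σ → ℝ)) (f : SR σ) (x : σ → ℝ) :
    quadMulS b f x = ((x ⬝ᵥ b x : ℝ) : ℂ) * f x := by
  rw [quadMulS, SchwartzMap.smulLeftCLM_apply_apply (hasTemperateGrowth_ofReal_quadForm b), smul_eq_mul]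

/-- The quadratic form through the matrix of `b`: `x·bx = Σ_{j,k} x_j B_{jk} x_k`, `B = toMatrix' b`. [folklore] -/
theorem dotProduct_apply_eq_sum (b : (σ → ℝ) →ₗ[ℝ] (σ → ℝ)) (x : σ → ℝ) :
    x ⬝ᵥ b x = ∑ j : σ, ∑ k : σ, x j * (LinearMap.toMatrix' b j k * x k) := by
  conv_lhs => rw [← Matrix.toLin'_toMatrix' b, Matrix.toLin'_apply]
  simp only [dotProduct, Matrix.mulVec, Finset.mul_sum]

/-- **The Gaussian second moment** (zero-point input): for the `L²`-normalised vacuum `h₀ = hermitePi 0`,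
`⟪h₀, (x·bx) h₀⟫_{L²(ℝ^σ)} = ∫ (x·bx) h₀(x)² dx = tr(b)/(4π)`. [cite: Folland1989, §1.7] -/
theorem inner_toL2_hermitePi_zero_quadMulS (b : (σ → ℝ) →ₗ[ℝ] (σ → ℝ)) :
    ⟪toL2 (hermitePi (0 : σ →₀ ℕ)), toL2 (quadMulS b (hermitePi 0))⟫_ℂ =
      (((LinearMap.toMatrix' b).trace / (4 * π) : ℝ) : ℂ) := by
  -- the left side as an integral over Folland's carrier
  have h1 : ⟪toL2 (hermitePi (0 : σ →₀ ℕ)), toL2 (quadMulS b (hermitePi 0))⟫_ℂ =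
      ∫ x : σ → ℝ, ((x ⬝ᵥ b x : ℝ) : ℂ) *
        (hermiteFun (herm (0 : σ →₀ ℕ)) x * hermiteFun (herm (0 : σ →₀ ℕ)) x) := by
    rw [toL2_hermitePi, inner_hermiteL2_left]
    refine integral_congr_ae ?_
    filter_upwards [coeFn_toL2 (quadMulS b (hermitePi 0))] with x hx
    rw [hx, quadMulS_apply, hermitePi_apply, conj_hermiteFun, map_conj_herm]
    ring
  -- the Euclidean side as the same integral
  have h2 : bpair (hermiteSchwartz (herm (0 : σ →₀ ℕ))) (quadHermZeroE (LinearMap.toMatrix' b)) =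
      ∫ y : EuclideanSpace ℝ σ, (((⇑y : σ → ℝ) ⬝ᵥ b ⇑y : ℝ) : ℂ) *
        (hermiteFun (herm (0 : σ →₀ ℕ)) (⇑y : σ → ℝ) * hermiteFun (herm (0 : σ →₀ ℕ)) (⇑y : σ → ℝ)) := by
    rw [bpair_apply]
    refine integral_congr_ae (Filter.Eventually.of_forall fun y => ?_)
    beta_reduce
    rw [quadHermZeroE_apply, hermiteSchwartz_apply, dotProduct_apply_eq_sum b]
    push_cast
    ring
  -- change of variables along the volume-preserving `euclE`
  have h3 : ∫ x : σ → ℝ, ((x ⬝ᵥ b x : ℝ) : ℂ) *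
        (hermiteFun (herm (0 : σ →₀ ℕ)) x * hermiteFun (herm (0 : σ →₀ ℕ)) x) =
      ∫ y : EuclideanSpace ℝ σ, (((⇑y : σ → ℝ) ⬝ᵥ b ⇑y : ℝ) : ℂ) *
        (hermiteFun (herm (0 : σ →₀ ℕ)) (⇑y : σ → ℝ) * hermiteFun (herm (0 : σ →₀ ℕ)) (⇑y : σ → ℝ)) := by
    rw [← measurePreserving_euclE.integral_comp (euclE σ).toHomeomorph.measurableEmbedding]
    rfl
  rw [h1, h3, ← h2, bpair_herm_zero_quadHermZeroE]

/-- The same with the intrinsic trace of `b`. [cite: Folland1989, §1.7] -/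
theorem inner_toL2_hermitePi_zero_quadMulS' (b : (σ → ℝ) →ₗ[ℝ] (σ → ℝ)) :
    ⟪toL2 (hermitePi (0 : σ →₀ ℕ)), toL2 (quadMulS b (hermitePi 0))⟫_ℂ =
      ((LinearMap.trace ℝ (σ → ℝ) b / (4 * π) : ℝ) : ℂ) := by
  rw [inner_toL2_hermitePi_zero_quadMulS, LinearMap.trace_eq_matrix_trace ℝ (Pi.basisFun ℝ σ) b,
    LinearMap.toMatrix_eq_toMatrix']

/-- **The vacuum is a unit vector**: `⟪h₀, h₀⟫ = 1`. [cite: Folland1989, §1.7 (vii)] -/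
theorem inner_toL2_hermitePi_zero_self :
    ⟪toL2 (hermitePi (0 : σ →₀ ℕ)), toL2 (hermitePi (0 : σ →₀ ℕ))⟫_ℂ = 1 := by
  rw [toL2_hermitePi]
  have h := orthonormal_iff_ite.1 (orthonormal_hermiteL2 (σ := σ)) 0 0
  rw [if_pos rfl] at h
  exact h

end Literature.Analysis.SegalBargmann
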